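import Summits.BirchSwinnertonDyer.BirchSwinnertonDyer.Theorems.PrintCf2SplitBadTwoMordellWeilCMFrame
import Summits.BirchSwinnertonDyer.BirchSwinnertonDyer.Theorems.PrintCf2SplitBadTwoKummerBranchInputs
import HarnessLib

/-!
# Crux `PrintCf2.SplitBadTwoRankOneOfFacts` (stmt-BirchSwinnertonDyer-20368), road α v10.3 — S3c (R-BV) factor (F1), GLOBAL HALF, file 3:
# THE `W*`-PART OF EVERY KUMMER CLASS IS A MULTIPLE OF THE `W*`-PART OF THE KUMMER CLASS OF THE ℚ-GENERATOR: `e_* κ_N(y) ∈ ℤ · e_* κ_N(P_K)`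

Cell `bsd-print-cf2`, width seat `bsd-line-cf2-p1-w6` g3 (prover-bsd-line-cf2-p1-w6-g3-0). `--supports stmt-BirchSwinnertonDyer-20368`
(helper, Theses-free). HONEST FRAMING: nothing here closes the crux or a registered stub; BSD is not proved by any of this; no summit
statement is proved by this seat. No definition, no named fact, no `sorry`.

WHAT. Files 1–2 (`…MordellWeilCMLatticeAlgebra` p672763, `…MordellWeilCMFrame` p673604) gave `7 · E(K) ⊆ ℤ P_K + ℤ P₁ + E(K)_tors`
(`P₁ = πP_K`) on every S3c frame. This file pushes it through the Kummer map: with -w7's equivariant projector `e` onto `W* = E[𝔮_r^∞]`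
(`e ∘ ι = id`, `e + e′ = id`), -w3 g9's (S) formula `ι_* e_* κ_N(P) = κ_N(w • (P₁ − N₂ • P))` (`…KummerBranchInputs`), and the
vanishing of torsion in `E(K) ⊗ ℚ_p/ℤ_p`:
* §1 `tmul_prufGen_eq_zero_of_isOfFinAddOrder`, `kummerMapLevel_eq_zero_of_isOfFinAddOrder` — `κ_N(T) = 0` for torsion `T` (ANY `V/K`, `p`);
  `pow_smul_kummerMapLevel` (`p^N • κ_N(y) = 0`); `exists_inv_mod_pow` (odd integers are invertible mod `2^N`).
* §2 **`proj_kummerMapLevel_pi_eq_zsmul`** (ANY `V/K`, `p`): `w • e_* κ_N(P₁) = (1 + w N₂) • e_* κ_N(P)` for the level data of (S).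
* §3 **`exists_proj_kummerMapLevel_eq_zsmul_of_frame`** — on the S3c frame (`p = 2`, `r′ = 1 − r`): for EVERY `y ∈ E(K)` and `N`,
  `e_* κ_N(y) = k • e_* κ_N(P_K)` for some `k : ℤ` — the `W*`-parts of all Kummer classes lie on the ℤ-line through `e_* κ_N(P_K)`;
  hence (**`exists_comap_kummer_eq_zsmul_of_frame`**) every element of -w7's `Q_M = ι_*⁻¹(res_⊤ range κ)` is `k • e_* res_⊤ κ_N(P_K)` for
  some `N, k` — `Q_M` IS THE INCREASING UNION OF THE CYCLIC GROUPS `ℤ · e_* res_⊤ κ_N(P_K)`: the GLOBAL HALF of (F1) (memo F1-DELTAQ §3).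
  What remains for (F1) is LOCAL at `v̄` (-w7 g3): the order of `loc_{v̄}`-kernel on this line = the 2-adic depth of `P` in `W(ℚ₂)` vs `ℓ`.
presearch: Greenberg LNM 1716 §2 (p. 62, the `p^∞` Kummer map), Rubin LNM 1716 §2–§3, Gross 1991 §5 — held; no fact filed. beyond-print theorem: no.

References: [GreenbergLNM1716] §2; [Rubin1999] §2–§3; [GrossLMS1991] §5 (5.1); [SilvermanAEC2009] VIII §2.
-/

noncomputable section

open scoped Classical TensorProduct

set_option linter.dupNamespace false
set_option autoImplicit false

open NumberField IsDedekindDomain Field WeierstrassCurve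
open Literature.NumberTheory.EllipticCurves Literature.NumberTheory.EllipticCurves.GreenbergSelmer
open Literature.NumberTheory.EllipticCurves.Castella2018.AcSelmer
open Literature.NumberTheory.EllipticCurves.Agboola2007
open Literature.NumberTheory.EllipticCurves.ResKernel
open Literature.NumberTheory.GaloisRepresentations

universe u

namespace Summit.BirchSwinnertonDyer.BirchSwinnertonDyer.Theorems.PrintCf2.RestrictedSelmerPair

open Summit.BirchSwinnertonDyer.BirchSwinnertonDyer.Theorems.PrintCf2.CMPrimes
open Summit.BirchSwinnertonDyer.BirchSwinnertonDyer.Theorems.PrintCf2.MordellWeilCM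

/-! ## §1. Torsion dies under the `p^∞` Kummer map; exponents -/

section Torsion

variable {K : Type u} [Field K] (V : WeierstrassCurve K) (p : ℕ) [Fact p.Prime]

omit [Fact p.Prime] in
/-- **Torsion dies in `E(K) ⊗ ℚ_p/ℤ_p`**: `T ⊗ e_N = 0` for `T` of finite order `n` (`e_N = n • [1/(n p^N)]` in the divisible group `ℚ_p/ℤ_p`).
[cite: GreenbergLNM1716, §2 (p. 62)] -/
theorem tmul_prufGen_eq_zero_of_isOfFinAddOrder [Fact p.Prime] {T : V.toAffine.Point} (hT : IsOfFinAddOrder T) (N : ℕ) :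
    (T ⊗ₜ[ℤ] prufGen p N : V.toAffine.Point ⊗[ℤ] PruferQuot p) = 0 := by
  obtain ⟨n, hn, hnT⟩ := (isOfFinAddOrder_iff_nsmul_eq_zero).mp hT
  -- `e_N = n • x` with `x = [1 / (n p^N)]`
  have hdiv : ∃ x : PruferQuot p, (n : ℤ) • x = prufGen p N := by
    refine ⟨((((n : ℚ_[p]) * (p : ℚ_[p]) ^ N)⁻¹ : ℚ_[p]) : ℚ_[p] ⧸ (PadicInt.subring p).toAddSubgroup), ?_⟩
    unfold prufGen
    rw [← QuotientAddGroup.mk_zsmul, zsmul_eq_mul]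
    congr 1
    have hn0 : (n : ℚ_[p]) ≠ 0 := by exact_mod_cast hn.ne'
    have hp0 : (p : ℚ_[p]) ^ N ≠ 0 := pow_ne_zero _ (Nat.cast_ne_zero.mpr (Fact.out : p.Prime).ne_zero)
    field_simp
    push_cast
    ring
  obtain ⟨x, hx⟩ := hdiv
  calc (T ⊗ₜ[ℤ] prufGen p N : V.toAffine.Point ⊗[ℤ] PruferQuot p)
      = T ⊗ₜ[ℤ] ((n : ℤ) • x) := by rw [hx]
    _ = ((n : ℤ) • T) ⊗ₜ[ℤ] x := (TensorProduct.smul_tmul (n : ℤ) T x).symm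
    _ = 0 := by rw [natCast_zsmul, hnT, TensorProduct.zero_tmul]

variable [V.IsElliptic] [PerfectField K]

omit [PerfectField K] in
/-- **`κ_N(T) = 0` for torsion `T`** (`κ_N(T) = κ(T ⊗ e_N)` and torsion dies in `E(K) ⊗ ℚ_p/ℤ_p`). [cite: GreenbergLNM1716, §2 (p. 62)] -/
theorem kummerMapLevel_eq_zero_of_isOfFinAddOrder {T : V.toAffine.Point} (hT : IsOfFinAddOrder T) (N : ℕ) :
    V.kummerMapLevel p V.zsmul_geomPoints_surjective_holds N T = 0 := by
  rw [← V.kummerMapPInfty_tmul_prufGen p V.zsmul_geomPoints_surjective_holds T N,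
    tmul_prufGen_eq_zero_of_isOfFinAddOrder V p hT N, map_zero]

omit [PerfectField K] in
/-- `p^N • κ_N(y) = 0` (`κ_N(p^N • y) = 0`). [cite: SilvermanAEC2009, VIII §2] -/
theorem pow_smul_kummerMapLevel (N : ℕ) (y : V.toAffine.Point) :
    ((p ^ N : ℕ) : ℤ) • V.kummerMapLevel p V.zsmul_geomPoints_surjective_holds N y = 0 := by
  rw [natCast_zsmul, ← map_nsmul, V.kummerMapLevel_nsmul_self p V.zsmul_geomPoints_surjective_holds N y]

end Torsion

/-- **Odd integers are invertible modulo `2^N`.** [folklore] -/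
theorem exists_mul_sub_one_dvd_of_odd {m : ℤ} (hm : Odd m) (N : ℕ) : ∃ u : ℤ, (2 : ℤ) ^ N ∣ m * u - 1 := by
  obtain ⟨k, rfl⟩ := hm
  have hcop : IsCoprime (2 * k + 1) ((2 : ℤ) ^ N) :=
    (show IsCoprime (2 * k + 1) (2 : ℤ) from ⟨1, -k, by ring⟩).pow_right
  obtain ⟨u, v, huv⟩ := hcop
  exact ⟨u, ⟨-v, by linarith⟩⟩

/-! ## §2. The `W*`-part of the Kummer class of `πP` is a multiple of that of `P` (from (S)) -/

section ProjPi

variable {K : Type u} [Field K] [NumberField K] (V : WeierstrassCurve K) [V.IsElliptic] (p : ℕ) [Fact p.Prime]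
  (π : V.endRing) (r r' : ℤ_[p])
  (e : V.geomPrimaryTorsion p →+ ↥(V.endEigenPrimaryTorsion p π r)) (e' : V.geomPrimaryTorsion p →+ ↥(V.endEigenPrimaryTorsion p π r'))
  (he₁ : ∀ x : ↥(V.endEigenPrimaryTorsion p π r), e x = x)
  (he : ∀ (σ : absoluteGaloisGroup K) (x : V.geomPrimaryTorsion p), e (σ • x) = σ • e x)
  (hsum : ∀ x, (e x : V.geomPrimaryTorsion p) + (e' x : V.geomPrimaryTorsion p) = x)

include he₁ in
omit [NumberField K] [V.IsElliptic] in
/-- `e_* ∘ ι_* = id` on `H¹(Γ_K, E[𝔮^∞])` (the `Γ_K`-level twin of -w7's `resH1Hom_proj_comp_subtype`). [cite: SerreGaloisCohomology1997, I.§2.4] -/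
theorem resH1Hom_proj_subtype_apply (x : discreteH1 (absoluteGaloisGroup K) ↥(V.endEigenPrimaryTorsion p π r)) :
    resH1Hom (ContinuousMonoidHom.id (absoluteGaloisGroup K)) e (fun σ x ↦ he σ x)
        (resH1Hom (ContinuousMonoidHom.id (absoluteGaloisGroup K)) (V.endEigenPrimaryTorsion p π r).subtype (fun _ _ ↦ rfl) x) = x := by
  have hcomp : e.comp (V.endEigenPrimaryTorsion p π r).subtype = AddMonoidHom.id _ := AddMonoidHom.ext fun x ↦ he₁ x
  have hφ : (ContinuousMonoidHom.id (absoluteGaloisGroup K)).comp (ContinuousMonoidHom.id (absoluteGaloisGroup K)) =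
      ContinuousMonoidHom.id (absoluteGaloisGroup K) := ContinuousMonoidHom.ext fun _ ↦ rfl
  have h := resH1Hom_comp (ContinuousMonoidHom.id (absoluteGaloisGroup K)) (V.endEigenPrimaryTorsion p π r).subtype
    (fun _ _ ↦ rfl) (ContinuousMonoidHom.id (absoluteGaloisGroup K)) e (fun σ x ↦ he σ x)
  have h' := DFunLike.congr_fun h x
  rw [AddMonoidHom.comp_apply] at h'
  rw [h', resH1Hom_congr hφ hcomp _ (fun _ _ ↦ rfl), resH1Hom_id]
  rfl

include he₁ hsum in
omit [NumberField K] in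
/-- **`w • e_* κ_N(πP) = (1 + w N₂) • e_* κ_N(P)`** for the level data `N₁ ≡ r`, `N₂ ≡ r′`, `w (N₁ − N₂) ≡ 1 (mod p^N)`: apply `e_*` to
-w3 g9's (S) `ι_* e_* κ_N(P) = κ_N(w • (P₁ − N₂ • P))` and use `e_* ι_* = id`. [cite: GreenbergLNM1716, §2] [cite: Rubin1999, §2] -/
theorem smul_proj_kummerMapLevel_pi_eq
    {N : ℕ} {N₁ N₂ w : ℤ} (hN₁ : ((N₁ : ℤ_[p]) - r) ∈ (Ideal.span {(p : ℤ_[p]) ^ N} : Ideal ℤ_[p]))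
    (hN₂ : ((N₂ : ℤ_[p]) - r') ∈ (Ideal.span {(p : ℤ_[p]) ^ N} : Ideal ℤ_[p]))
    (hw : (((w * (N₁ - N₂) : ℤ) : ℤ_[p]) - 1) ∈ (Ideal.span {(p : ℤ_[p]) ^ N} : Ideal ℤ_[p]))
    (P P₁ : V.toAffine.Point) (hP₁ : toGeomPoints V P₁ = (π : AddMonoid.End V.geomPoints) (toGeomPoints V P)) :
    w • resH1Hom (ContinuousMonoidHom.id (absoluteGaloisGroup K)) e (fun σ x ↦ he σ x)
        (V.kummerMapLevel p V.zsmul_geomPoints_surjective_holds N P₁) =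
      (1 + w * N₂) • resH1Hom (ContinuousMonoidHom.id (absoluteGaloisGroup K)) e (fun σ x ↦ he σ x)
        (V.kummerMapLevel p V.zsmul_geomPoints_surjective_holds N P) := by
  have hS := resH1Hom_subtype_proj_kummerMapLevel V p π r r' e e' he hsum hN₁ hN₂ hw P P₁ hP₁
  have key := congrArg (resH1Hom (ContinuousMonoidHom.id (absoluteGaloisGroup K)) e (fun σ x ↦ he σ x)) hS
  rw [resH1Hom_proj_subtype_apply V p π r e he₁ he] at key
  -- `key : e_* κ_N(P) = e_* κ_N(w • (P₁ - N₂ • P)) = w • e_* κ_N(P₁) - w • (N₂ • e_* κ_N(P))`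
  simp only [map_zsmul, map_sub] at key
  rw [zsmul_sub] at key
  -- so `w • e_* κ_N(P₁) = e_* κ_N(P) + w • N₂ • e_* κ_N(P)`
  have key' := (sub_eq_iff_eq_add.mp key.symm)
  rw [key', add_zsmul, one_zsmul, mul_zsmul, add_comm]

end ProjPi

/-! ## §3. On the S3c frame: every `W*`-Kummer class is a multiple of `e_* κ_N(P_K)`; `Q_M` is the line of the ℚ-generator -/

section Frame

variable (W : WeierstrassCurve ℚ) [W.IsElliptic] (K : Type) [Field K] [NumberField K]

/-- `w (N₁ − N₂) ≡ 1 (mod 2^N)` with `N ≥ 1` forces `w` odd. [folklore] -/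
theorem odd_of_levelData {N : ℕ} (hN : N ≠ 0) {N₁ N₂ w : ℤ}
    (hw : (((w * (N₁ - N₂) : ℤ) : ℤ_[2]) - 1) ∈ (Ideal.span {(2 : ℤ_[2]) ^ N} : Ideal ℤ_[2])) : Odd w := by
  haveI : Fact (Nat.Prime 2) := ⟨Nat.prime_two⟩
  have h2 : ((w * (N₁ - N₂) - 1 : ℤ) : ℤ_[2]) ∈ (Ideal.span {((2 : ℕ) : ℤ_[2]) ^ N} : Ideal ℤ_[2]) := by
    rw [Int.cast_sub, Int.cast_one, Nat.cast_ofNat]; exact hw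
  rw [← PadicInt.norm_le_pow_iff_mem_span_pow, PadicInt.norm_int_le_pow_iff_dvd] at h2
  have h2' : (2 : ℤ) ∣ w * (N₁ - N₂) - 1 := (dvd_pow_self 2 hN).trans (by exact_mod_cast h2)
  rw [← Int.not_even_iff_odd]
  intro hw2
  have : (2 : ℤ) ∣ 1 := by
    have := (Int.dvd_sub (hw2.two_dvd.mul_right (N₁ - N₂)) h2')
    simp at this
  omega

/-- **THE `W*`-PART OF EVERY KUMMER CLASS LIES ON THE ℤ-LINE OF `e_* κ_N(P_K)`.** On the S3c frame (`K` imaginary quadratic, `π² = π − 2`,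
eigen-splitting with `r − r′` a unit, equivariant projectors `e, e′` with `e ∘ ι = id`, `e + e′ = id`; `P` the ℚ-generator): for every
`y ∈ E(K)` and every level `N` there is `k : ℤ` with `e_* κ_N(y) = k • e_* κ_N(P_K)`. Proof: `7y = aP_K + bP₁ + T` (file 2), `κ_N(T) = 0`,
`w • e_* κ_N(P₁) = (1 + wN₂) • e_* κ_N(P_K)` (§2), and `7w` is invertible modulo `2^N` while `2^N • κ_N = 0`.
[cite: GreenbergLNM1716, §2] [cite: Rubin1999, §2–§3] -/
theorem exists_proj_kummerMapLevel_eq_zsmul_of_frame (hK : IsImaginaryQuadratic K)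
    (π : (W.baseChange K).endRing) (hrel : (π : AddMonoid.End (W.baseChange K).geomPoints) * π = π - 2)
    {r r' : ℤ_[2]} (hunit : IsUnit (r - r'))
    (e : (W.baseChange K).geomPrimaryTorsion 2 →+ ↥((W.baseChange K).endEigenPrimaryTorsion 2 π r))
    (e' : (W.baseChange K).geomPrimaryTorsion 2 →+ ↥((W.baseChange K).endEigenPrimaryTorsion 2 π r'))
    (he₁ : ∀ x : ↥((W.baseChange K).endEigenPrimaryTorsion 2 π r), e x = x)
    (he : ∀ (σ : absoluteGaloisGroup K) (x : (W.baseChange K).geomPrimaryTorsion 2), e (σ • x) = σ • e x)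
    (hsum : ∀ x, (e x : (W.baseChange K).geomPrimaryTorsion 2) + (e' x : (W.baseChange K).geomPrimaryTorsion 2) = x)
    {P : W.toAffine.Point} (hP : ¬ IsOfFinAddOrder P)
    (hgen : ∀ R : W.toAffine.Point, ∃ (k : ℤ) (T : W.toAffine.Point), IsOfFinAddOrder T ∧ R = k • P + T)
    (y : (W.baseChange K).toAffine.Point) (N : ℕ) :
    ∃ k : ℤ, resH1Hom (ContinuousMonoidHom.id (absoluteGaloisGroup K)) e (fun σ x ↦ he σ x)
        ((W.baseChange K).kummerMapLevel 2 (W.baseChange K).zsmul_geomPoints_surjective_holds N y) =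
      k • resH1Hom (ContinuousMonoidHom.id (absoluteGaloisGroup K)) e (fun σ x ↦ he σ x)
        ((W.baseChange K).kummerMapLevel 2 (W.baseChange K).zsmul_geomPoints_surjective_holds N
          (Affine.Point.map (W' := W.toAffine) (Algebra.ofId ℚ K) P)) := by
  haveI : Fact (Nat.Prime 2) := ⟨Nat.prime_two⟩
  -- the lattice relation `7y = a P_K + b P₁ + T`
  obtain ⟨P₁, hP₁, hseven⟩ := seven_smul_mem_of_frame W K hK π hrel hP hgen
  obtain ⟨a, b, T, hT, h7⟩ := hseven y
  -- level data and §2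
  obtain ⟨N₁, N₂, w, hN₁, hN₂, hw⟩ := exists_proj_levelData (p := 2) (r := r) (r' := r') hunit N
  have hpi := smul_proj_kummerMapLevel_pi_eq (W.baseChange K) 2 π r r' e e' he₁ he hsum hN₁ hN₂ hw
    (Affine.Point.map (W' := W.toAffine) (Algebra.ofId ℚ K) P) P₁ hP₁
  -- abbreviations (by `have`-equations, no `set`)
  have h7κ : (7 : ℤ) • resH1Hom (ContinuousMonoidHom.id (absoluteGaloisGroup K)) e (fun σ x ↦ he σ x)
        ((W.baseChange K).kummerMapLevel 2 (W.baseChange K).zsmul_geomPoints_surjective_holds N y) =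
      a • resH1Hom (ContinuousMonoidHom.id (absoluteGaloisGroup K)) e (fun σ x ↦ he σ x)
        ((W.baseChange K).kummerMapLevel 2 (W.baseChange K).zsmul_geomPoints_surjective_holds N
          (Affine.Point.map (W' := W.toAffine) (Algebra.ofId ℚ K) P)) +
      b • resH1Hom (ContinuousMonoidHom.id (absoluteGaloisGroup K)) e (fun σ x ↦ he σ x)
        ((W.baseChange K).kummerMapLevel 2 (W.baseChange K).zsmul_geomPoints_surjective_holds N P₁) := by
    rw [← map_zsmul, ← map_zsmul ((W.baseChange K).kummerMapLevel 2 _ N), h7]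
    simp only [map_add, map_zsmul, kummerMapLevel_eq_zero_of_isOfFinAddOrder (W.baseChange K) 2 hT N, add_zero]
  -- `2^N` kills every `e_* κ_N(·)`
  have hkill : ∀ z : (W.baseChange K).toAffine.Point, ((2 : ℤ) ^ N) •
      resH1Hom (ContinuousMonoidHom.id (absoluteGaloisGroup K)) e (fun σ x ↦ he σ x)
        ((W.baseChange K).kummerMapLevel 2 (W.baseChange K).zsmul_geomPoints_surjective_holds N z) = 0 := fun z ↦ by
    rw [← map_zsmul]
    have := pow_smul_kummerMapLevel (W.baseChange K) 2 N z
    push_cast at this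
    rw [this, map_zero]
  by_cases hN0 : N = 0
  · subst hN0
    refine ⟨0, ?_⟩
    rw [zero_zsmul]
    have := hkill y
    rwa [pow_zero, one_zsmul] at this
  -- `7w` is odd, hence invertible mod `2^N`
  have hwodd : Odd (7 * w) := Int.odd_mul.mpr ⟨by decide, odd_of_levelData hN0 hw⟩
  obtain ⟨u, q, hq⟩ := exists_mul_sub_one_dvd_of_odd hwodd N
  refine ⟨u * (a * w + b * (1 + w * N₂)), ?_⟩
  -- `X = (7wu) • X - (7wu - 1) • X`, `(7wu - 1) • X = 0`, `(7w) • X = (a w + b(1 + w N₂)) • e_* κ_N(P_K)`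
  set Xy := resH1Hom (ContinuousMonoidHom.id (absoluteGaloisGroup K)) e (fun σ x ↦ he σ x)
        ((W.baseChange K).kummerMapLevel 2 (W.baseChange K).zsmul_geomPoints_surjective_holds N y) with hXy
  set XP := resH1Hom (ContinuousMonoidHom.id (absoluteGaloisGroup K)) e (fun σ x ↦ he σ x)
        ((W.baseChange K).kummerMapLevel 2 (W.baseChange K).zsmul_geomPoints_surjective_holds N
          (Affine.Point.map (W' := W.toAffine) (Algebra.ofId ℚ K) P)) with hXP
  set XP₁ := resH1Hom (ContinuousMonoidHom.id (absoluteGaloisGroup K)) e (fun σ x ↦ he σ x)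
        ((W.baseChange K).kummerMapLevel 2 (W.baseChange K).zsmul_geomPoints_surjective_holds N P₁) with hXP₁
  have hdead : (7 * w * u - 1) • Xy = 0 := by
    have hk := hkill y
    rw [hq, mul_comm, mul_zsmul, hk, zsmul_zero]
  have h7w : (7 * w) • Xy = (a * w + b * (1 + w * N₂)) • XP := by
    have s1 : (7 * w) • Xy = w • ((7 : ℤ) • Xy) := by rw [mul_comm, mul_zsmul]
    have s3 : w • (a • XP + b • XP₁) = (w * a) • XP + b • (w • XP₁) := by
      rw [zsmul_add, ← mul_zsmul, ← mul_zsmul, mul_comm w b, mul_zsmul, mul_zsmul]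
    have s4 : b • (w • XP₁) = (b * (1 + w * N₂)) • XP := by rw [hpi, ← mul_zsmul]
    rw [s1, h7κ, s3, s4, ← add_zsmul]
    congr 1
    ring
  have hsplit : Xy = (7 * w * u) • Xy - (7 * w * u - 1) • Xy := by
    rw [sub_zsmul, one_zsmul]; abel
  rw [hsplit, hdead, sub_zero, show (7 : ℤ) * w * u = u * (7 * w) by ring, mul_zsmul, h7w, ← mul_zsmul]

/-- **`Q_M` IS THE LINE OF THE ℚ-GENERATOR.** On the S3c frame, every element `q` of -w7's canonical Kummer subgroup
`Q_M = ι_*⁻¹(res_⊤(range κ)) ≤ H¹(⊤, W*)` (`κ = kummerMapPInfty`) is `k • e_* res_⊤ κ_N(P_K)` for some level `N` and `k : ℤ`: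
`Q_M = ⋃_N ℤ · e_* res_⊤ κ_N(P_K)` — the GLOBAL half of (F1). (Every `t ∈ E(K) ⊗ ℚ₂/ℤ₂` is `y ⊗ e_N`; `q = e_* ι_* q = e_* res_⊤ κ_N(y)`;
then `exists_proj_kummerMapLevel_eq_zsmul_of_frame` and `res_⊤ ∘ e_* = e_* ∘ res_⊤`.) [cite: GreenbergLNM1716, §2] [cite: Rubin1999, §2–§3] -/
theorem exists_comap_kummer_eq_zsmul_of_frame (hK : IsImaginaryQuadratic K)
    (π : (W.baseChange K).endRing) (hrel : (π : AddMonoid.End (W.baseChange K).geomPoints) * π = π - 2)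
    {r r' : ℤ_[2]} (hunit : IsUnit (r - r'))
    (e : (W.baseChange K).geomPrimaryTorsion 2 →+ ↥((W.baseChange K).endEigenPrimaryTorsion 2 π r))
    (e' : (W.baseChange K).geomPrimaryTorsion 2 →+ ↥((W.baseChange K).endEigenPrimaryTorsion 2 π r'))
    (he₁ : ∀ x : ↥((W.baseChange K).endEigenPrimaryTorsion 2 π r), e x = x)
    (he : ∀ (σ : absoluteGaloisGroup K) (x : (W.baseChange K).geomPrimaryTorsion 2), e (σ • x) = σ • e x)
    (hsum : ∀ x, (e x : (W.baseChange K).geomPrimaryTorsion 2) + (e' x : (W.baseChange K).geomPrimaryTorsion 2) = x)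
    {P : W.toAffine.Point} (hP : ¬ IsOfFinAddOrder P)
    (hgen : ∀ R : W.toAffine.Point, ∃ (k : ℤ) (T : W.toAffine.Point), IsOfFinAddOrder T ∧ R = k • P + T)
    {q : discreteH1 (⊤ : Subgroup (absoluteGaloisGroup K)) ↥((W.baseChange K).endEigenPrimaryTorsion 2 π r)}
    (hq : q ∈ ((((W.baseChange K).kummerMapPInfty 2 (W.baseChange K).zsmul_geomPoints_surjective_holds).range).map
            (resSubgroup ⊤ ((W.baseChange K).geomPrimaryTorsion 2))).comap
          (resH1Hom (ContinuousMonoidHom.id _) ((W.baseChange K).endEigenPrimaryTorsion 2 π r).subtype (fun _ _ ↦ rfl))) :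
    ∃ (N : ℕ) (k : ℤ), q = k • resH1Hom (ContinuousMonoidHom.id _) e
        (fun σ x ↦ by rw [Subgroup.smul_def, Subgroup.smul_def]; exact he σ x)
        (resSubgroup (⊤ : Subgroup (absoluteGaloisGroup K)) ((W.baseChange K).geomPrimaryTorsion 2)
          ((W.baseChange K).kummerMapLevel 2 (W.baseChange K).zsmul_geomPoints_surjective_holds N
            (Affine.Point.map (W' := W.toAffine) (Algebra.ofId ℚ K) P))) := by
  haveI : Fact (Nat.Prime 2) := ⟨Nat.prime_two⟩
  rw [AddSubgroup.mem_comap, AddSubgroup.mem_map] at hq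
  obtain ⟨y₀, hy₀, hιq⟩ := hq
  obtain ⟨t, rfl⟩ := AddMonoidHom.mem_range.mp hy₀
  obtain ⟨y, N, rfl⟩ := (W.baseChange K).exists_eq_tmul_prufGen 2 t
  rw [(W.baseChange K).kummerMapPInfty_tmul_prufGen 2 (W.baseChange K).zsmul_geomPoints_surjective_holds y N] at hιq
  obtain ⟨k, hk⟩ := exists_proj_kummerMapLevel_eq_zsmul_of_frame W K hK π hrel hunit e e' he₁ he hsum hP hgen y N
  refine ⟨N, k, ?_⟩
  -- `q = e_* ι_* q = e_* res_⊤ κ_N(y)`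
  have hid := resH1Hom_proj_comp_subtype (W.baseChange K) 2 π r (⊤ : Subgroup (absoluteGaloisGroup K)) e he₁ he
  have hq' : q = resH1Hom (ContinuousMonoidHom.id _) e (fun σ x ↦ by rw [Subgroup.smul_def, Subgroup.smul_def]; exact he σ x)
      (resSubgroup (⊤ : Subgroup (absoluteGaloisGroup K)) ((W.baseChange K).geomPrimaryTorsion 2)
        ((W.baseChange K).kummerMapLevel 2 (W.baseChange K).zsmul_geomPoints_surjective_holds N y)) := by
    have := DFunLike.congr_fun hid q
    rw [AddMonoidHom.comp_apply, AddMonoidHom.id_apply] at this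
    rw [hιq]
    exact this.symm
  -- `res_⊤ ∘ e_* = e_* ∘ res_⊤` (naturality), then the `Γ_K`-level multiple
  have hnat := resH1Hom_comp_resSubgroup (ContinuousMonoidHom.id (absoluteGaloisGroup K)) e (fun σ x ↦ he σ x)
    (⊤ : Subgroup (absoluteGaloisGroup K)) (⊤ : Subgroup (absoluteGaloisGroup K)) (ContinuousMonoidHom.id _) (fun _ ↦ rfl)
    (fun σ x ↦ by rw [Subgroup.smul_def, Subgroup.smul_def]; exact he σ x)
  have hcomm : ∀ z, resH1Hom (ContinuousMonoidHom.id _) e (fun σ x ↦ by rw [Subgroup.smul_def, Subgroup.smul_def]; exact he σ x)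
      (resSubgroup (⊤ : Subgroup (absoluteGaloisGroup K)) ((W.baseChange K).geomPrimaryTorsion 2) z) =
      resSubgroup (⊤ : Subgroup (absoluteGaloisGroup K)) _
        (resH1Hom (ContinuousMonoidHom.id (absoluteGaloisGroup K)) e (fun σ x ↦ he σ x) z) := fun z ↦ by
    have := DFunLike.congr_fun hnat z
    simp only [AddMonoidHom.comp_apply] at this
    exact this
  rw [hq', hcomm, hk, map_zsmul, ← hcomm]

end Frame

end Summit.BirchSwinnertonDyer.BirchSwinnertonDyer.Theorems.PrintCf2.RestrictedSelmerPair

end
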